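import Mathlib.Analysis.SpecialFunctions.Gaussian.PoissonSummation
import Literature.Analysis.FunctionSpaces.TorusHeatKernel
import HarnessLib

/-!
# The trace of the heat semigroup on `T^d`: `∑ₖ e^{-4π²|k|²t} − 1 ≤ C t^{-d/2}`

Analysis/FunctionSpaces support file (everything proved; no definitions, no named facts), sequel of
`TorusHeatKernel.lean` (the heat coefficients `heatCoeff t k = e^{-4π²|k|²t}`, their summability and
the large-time bound `Torus.tsum_heatCoeff_sub_one_le`). It proves the **small-time behaviour of
the theta function of the lattice `ℤ^d`**, i.e. of the trace `Θ(t) = ∑_{k ∈ ℤ^d} e^{-4π²|k|²t}`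
of the heat semigroup of the unit torus:

* `Torus.tsum_pi_prod_le_tsum_pow` — the product trick with the bound kept:
  `∑_{k ∈ ℤ^d} ∏ᵢ a(kᵢ) ≤ (∑_{j ∈ ℤ} a(j))^{#d}` for nonnegative summable `a`;
* `Torus.tsum_int_exp_neg_sq_le` — **Jacobi's transformation as an inequality**: for
  `0 < t ≤ 1`, `∑_{n ∈ ℤ} e^{-4π²tn²} ≤ Z · (4πt)^{-1/2}` with `Z = ∑_{n ∈ ℤ} e^{-n²/4}`, from
  Mathlib's Poisson-summation identity `∑ e^{-πan²} = a^{-1/2} ∑ e^{-πn²/a}`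
  (`Real.tsum_exp_neg_mul_int_sq`, `a = 4πt`) and the monotonicity of the dual sum;
* `Torus.tsum_heatCoeff_le_rpow_of_le_one` — `Θ(t) ≤ Z^{#d} (4πt)^{-#d/2}` for `0 < t ≤ 1`;
* `Torus.tsum_heatCoeff_sub_one_le_rpow` — **the two-sided bound**: there is `C ≥ 0` with
  `Θ(t) − 1 ≤ C t^{-#d/2}` for every `t > 0` (small `t` from the previous item, large `t` from
  the exponential decay `Torus.tsum_heatCoeff_sub_one_le` and `e^{-4π²t} ≤ n! t^{-n}`).

These are the lattice-sum inputs of the Fourier-side proofs of the Sobolev and Agmon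
inequalities on `T³` (`∑_{k ≠ 0} e^{-s|k|²}/|k|² ≲ s^{-1/2}` etc. follow by integrating `Θ − 1`
in time), cf. Constantin–Foias 1988, Ch. 4 and Foias–Manley–Rosa–Temam 2001, Ch. II App. A
(A.28)–(A.29).

## Mathlib / tree search

Mathlib: `Real.tsum_exp_neg_mul_int_sq` (Poisson summation for the Gaussian), `jacobiTheta`
and its modular transformation (complex form); no real-variable bound `θ(t) ≲ t^{-1/2}` stated.
Tree: `TorusHeatKernel` (`heatCoeff`, `summable_heatCoeff`, `heatCoeff_eq_prod`,
`tsum_heatCoeff_sub_one_le` for `t ≥ 1`, `one_le_tsum_heatCoeff`), `TorusFourierSeries`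
(`summable_pi_prod_of_summable`, `exists_subset_piFinset`); searched `theta`, `rpow` with
`heatCoeff`, `exp_neg` with `sqrt`: no small-time bound.

## References

* E. M. Stein, G. Weiss, *Introduction to Fourier Analysis on Euclidean Spaces*, PUP 1971,
  Ch. VII §2, Cor. 2.6 (Poisson summation for the Gaussian / theta transformation). [SteinWeiss1971]
* P. Constantin, C. Foias, *Navier–Stokes Equations*, Univ. Chicago Press 1988, Ch. 4
  (Sobolev/Agmon inequalities on the torus through Fourier series). [ConstantinFoias1988]
-/

noncomputable section

open Filter Topology Real

namespace Literature.Analysis.FunctionSpaces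

namespace Torus

variable {d : Type*} [Fintype d]

/-! ### The product trick with the bound -/

/-- **Lattice sums of products are bounded by powers of one-dimensional sums**: for
nonnegative summable `a : ℤ → ℝ`, `∑_{k ∈ ℤ^d} ∏ᵢ a(kᵢ) ≤ (∑_{j ∈ ℤ} a(j))^{#d}` (every finite
partial sum lies in a cube, on which the sum factorises; `Finset.sum_prod_piFinset`).
[folklore] -/
theorem tsum_pi_prod_le_tsum_pow {a : ℤ → ℝ} (ha : ∀ j, 0 ≤ a j) (hs : Summable a) :
    ∑' k : d → ℤ, ∏ i, a (k i) ≤ (∑' j, a j) ^ Fintype.card d := by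
  classical
  have hnn : ∀ k : d → ℤ, 0 ≤ ∏ i, a (k i) := fun k => Finset.prod_nonneg fun i _ => ha _
  refine Real.tsum_le_of_sum_le (fun k => hnn k) fun u => ?_
  obtain ⟨T, hsub⟩ := exists_subset_piFinset u
  have h1 : ∑ k ∈ u, ∏ i, a (k i) ≤ ∑ k ∈ Fintype.piFinset (fun _ : d => T), ∏ i, a (k i) :=
    Finset.sum_le_sum_of_subset_of_nonneg hsub fun k _ _ => hnn k
  have h2 : ∑ k ∈ Fintype.piFinset (fun _ : d => T), ∏ i, a (k i) = ∏ _i : d, ∑ j ∈ T, a j :=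
    Finset.sum_prod_piFinset T fun (_ : d) j => a j
  have h3 : ∏ _i : d, ∑ j ∈ T, a j ≤ ∏ _i : d, ∑' j, a j :=
    Finset.prod_le_prod (fun i _ => Finset.sum_nonneg fun j _ => ha j)
      fun i _ => hs.sum_le_tsum T fun j _ => ha j
  simp only [Finset.prod_const, Finset.card_univ] at h2 h3
  linarith

/-! ### The one-dimensional theta function for small time -/

/-- **Jacobi's transformation as an inequality.** For `0 < t ≤ 1`,
`∑_{n ∈ ℤ} e^{-4π²tn²} ≤ (∑_{n ∈ ℤ} e^{-n²/4}) · (4πt)^{-1/2}`: by Poisson summation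
`∑ₙ e^{-πan²} = a^{-1/2} ∑ₙ e^{-πn²/a}` (`Real.tsum_exp_neg_mul_int_sq` with `a = 4πt`), and for
`t ≤ 1` the dual Gaussian `e^{-n²/(4t)}` is at most `e^{-n²/4}`. [cite: SteinWeiss1971, Ch. VII §2 Cor. 2.6] -/
theorem tsum_int_exp_neg_sq_le {t : ℝ} (ht : 0 < t) (ht1 : t ≤ 1) :
    ∑' n : ℤ, Real.exp (-(4 * π ^ 2 * t * (n : ℝ) ^ 2)) ≤
      (∑' n : ℤ, Real.exp (-((n : ℝ) ^ 2 / 4))) * (4 * π * t) ^ (-(1 / 2 : ℝ)) := by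
  have ha : 0 < 4 * π * t := by positivity
  -- the Gaussian sums `∑ₙ e^{-cn²}`, `c > 0`, converge (`summable_int_exp_neg_mul_sq_sub`)
  have hsum : ∀ {c : ℝ}, 0 < c → Summable fun n : ℤ => Real.exp (-(c * (n : ℝ) ^ 2)) :=
    fun hc => by simpa using summable_int_exp_neg_mul_sq_sub hc 0
  -- Poisson summation
  have hP := Real.tsum_exp_neg_mul_int_sq ha
  have e1 : (fun n : ℤ => Real.exp (-π * (4 * π * t) * (n : ℝ) ^ 2)) =
      fun n : ℤ => Real.exp (-(4 * π ^ 2 * t * (n : ℝ) ^ 2)) := by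
    funext n; congr 1; ring
  rw [e1] at hP
  rw [hP]
  -- the dual sum is at most `Z = ∑ e^{-n²/4}`
  have hdual : ∑' n : ℤ, Real.exp (-π / (4 * π * t) * (n : ℝ) ^ 2) ≤
      ∑' n : ℤ, Real.exp (-((n : ℝ) ^ 2 / 4)) := by
    have e2 : (fun n : ℤ => Real.exp (-π / (4 * π * t) * (n : ℝ) ^ 2)) =
        fun n : ℤ => Real.exp (-((1 / (4 * t)) * (n : ℝ) ^ 2)) := by
      funext n; congr 1; field_simp
    have e3 : (fun n : ℤ => Real.exp (-((n : ℝ) ^ 2 / 4))) =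
        fun n : ℤ => Real.exp (-((1 / 4) * (n : ℝ) ^ 2)) := by
      funext n; congr 1; ring
    rw [e2, e3]
    refine (hsum (by positivity)).tsum_le_tsum (fun n => ?_) (hsum (by norm_num))
    rw [Real.exp_le_exp, neg_le_neg_iff]
    have hn : 0 ≤ (n : ℝ) ^ 2 := sq_nonneg _
    have h14 : (1 : ℝ) / 4 ≤ 1 / (4 * t) :=
      one_div_le_one_div_of_le (by positivity) (by linarith)
    exact mul_le_mul_of_nonneg_right h14 hn
  have hZ0 : 0 ≤ ∑' n : ℤ, Real.exp (-((n : ℝ) ^ 2 / 4)) := tsum_nonneg fun n => (Real.exp_pos _).le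
  rw [Real.rpow_neg ha.le, one_div, mul_comm]
  exact mul_le_mul_of_nonneg_right hdual (inv_nonneg.2 (Real.rpow_nonneg ha.le _))

/-! ### The theta function of `ℤ^d` -/

/-- **Small-time bound of the heat trace**: for `0 < t ≤ 1`,
`∑_{k ∈ ℤ^d} e^{-4π²|k|²t} ≤ Z^{#d} (4πt)^{-#d/2}`, `Z = ∑_{n ∈ ℤ} e^{-n²/4}` (the coefficients
factor over the coordinates, `heatCoeff_eq_prod`, the lattice sum of the product is at most the
power of the one-dimensional sum, and `tsum_int_exp_neg_sq_le`). [folklore] -/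
theorem tsum_heatCoeff_le_rpow_of_le_one {t : ℝ} (ht : 0 < t) (ht1 : t ≤ 1) :
    ∑' k : d → ℤ, heatCoeff t k ≤
      (∑' n : ℤ, Real.exp (-((n : ℝ) ^ 2 / 4))) ^ Fintype.card d *
        (4 * π * t) ^ (-((Fintype.card d : ℝ) / 2)) := by
  have ha : 0 < 4 * π * t := by positivity
  set a : ℤ → ℝ := fun n => Real.exp (-(4 * π ^ 2 * t * (n : ℝ) ^ 2)) with ha_def
  have ha0 : ∀ j, 0 ≤ a j := fun j => (Real.exp_pos _).le
  have has : Summable a := by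
    simpa using summable_int_exp_neg_mul_sq_sub (c := 4 * π ^ 2 * t) (by positivity) 0
  have hprod : (fun k : d → ℤ => heatCoeff t k) = fun k => ∏ i, a (k i) := by
    funext k; exact heatCoeff_eq_prod t k
  have hS0 : 0 ≤ ∑' j, a j := tsum_nonneg ha0
  calc ∑' k : d → ℤ, heatCoeff t k = ∑' k : d → ℤ, ∏ i, a (k i) := by rw [hprod]
    _ ≤ (∑' j, a j) ^ Fintype.card d := tsum_pi_prod_le_tsum_pow ha0 has
    _ ≤ ((∑' n : ℤ, Real.exp (-((n : ℝ) ^ 2 / 4))) * (4 * π * t) ^ (-(1 / 2 : ℝ))) ^ Fintype.card d :=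
        pow_le_pow_left₀ hS0 (tsum_int_exp_neg_sq_le ht ht1) _
    _ = (∑' n : ℤ, Real.exp (-((n : ℝ) ^ 2 / 4))) ^ Fintype.card d *
          (4 * π * t) ^ (-((Fintype.card d : ℝ) / 2)) := by
        rw [mul_pow, ← Real.rpow_natCast ((4 * π * t) ^ (-(1 / 2 : ℝ))), ← Real.rpow_mul ha.le]
        congr 2
        ring

/-- **The heat trace of `T^d` minus the zero mode decays like `t^{-d/2}`, all times**: there is
`C ≥ 0` with `∑_{k ∈ ℤ^d} e^{-4π²|k|²t} − 1 ≤ C t^{-#d/2}` for every `t > 0`. Small `t`: the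
previous bound (and `−1 ≤ 0`); large `t`: `∑ₖ e^{-4π²|k|²t} − 1 ≤ e^{-4π²(t-1)} (Θ(1) − 1)`
(`Torus.tsum_heatCoeff_sub_one_le`) with `e^{-4π²t} ≤ n!/(4π²t)ⁿ ≤ n! t^{-n} ≤ n! t^{-n/2}`,
`n = #d`, `t ≥ 1`. [folklore] -/
theorem tsum_heatCoeff_sub_one_le_rpow :
    ∃ C : ℝ, 0 ≤ C ∧ ∀ t : ℝ, 0 < t →
      (∑' k : d → ℤ, heatCoeff t k) - 1 ≤ C * t ^ (-((Fintype.card d : ℝ) / 2)) := by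
  classical
  set n : ℕ := Fintype.card d with hn
  set Z : ℝ := ∑' m : ℤ, Real.exp (-((m : ℝ) ^ 2 / 4)) with hZ
  have hZ0 : 0 ≤ Z := tsum_nonneg fun m => (Real.exp_pos _).le
  set Θ₁ : ℝ := ∑' k : d → ℤ, heatCoeff 1 k with hΘ₁
  have hΘ₁ge : 1 ≤ Θ₁ := one_le_tsum_heatCoeff one_pos
  set Csmall : ℝ := Z ^ n * (4 * π) ^ (-((n : ℝ) / 2)) with hCs
  set Clarge : ℝ := Real.exp (4 * π ^ 2) * (n.factorial : ℝ) * (Θ₁ - 1) with hCl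
  have hCs0 : 0 ≤ Csmall := by rw [hCs]; positivity
  have hCl0 : 0 ≤ Clarge := by
    rw [hCl]
    exact mul_nonneg (by positivity) (by linarith)
  refine ⟨Csmall + Clarge, add_nonneg hCs0 hCl0, fun t ht => ?_⟩
  have htr : 0 < t ^ (-((n : ℝ) / 2)) := Real.rpow_pos_of_pos ht _
  rcases le_or_gt t 1 with ht1 | ht1
  · -- ### small time
    have h := tsum_heatCoeff_le_rpow_of_le_one (d := d) ht ht1
    have hsplit : (4 * π * t) ^ (-((n : ℝ) / 2)) = (4 * π) ^ (-((n : ℝ) / 2)) * t ^ (-((n : ℝ) / 2)) :=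
      Real.mul_rpow (by positivity) ht.le
    rw [← hn, hsplit, ← mul_assoc] at h
    calc (∑' k : d → ℤ, heatCoeff t k) - 1 ≤ ∑' k : d → ℤ, heatCoeff t k := by linarith
      _ ≤ Csmall * t ^ (-((n : ℝ) / 2)) := h
      _ ≤ (Csmall + Clarge) * t ^ (-((n : ℝ) / 2)) := by
          gcongr
          linarith
  · -- ### large time
    have h := tsum_heatCoeff_sub_one_le (d := d) ht1.le
    -- `e^{-4π²(t-1)} ≤ e^{4π²} n! t^{-n} ≤ e^{4π²} n! t^{-n/2}`
    have hexp : Real.exp (-(4 * π ^ 2 * (t - 1))) ≤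
        Real.exp (4 * π ^ 2) * (n.factorial : ℝ) * t ^ (-((n : ℝ) / 2)) := by
      have h4π : (1 : ℝ) ≤ 4 * π ^ 2 := by nlinarith [Real.two_le_pi]
      have hx : 0 ≤ 4 * π ^ 2 * t := by positivity
      -- `(4π²t)ⁿ/n! ≤ e^{4π²t}`
      have hpow := Real.pow_div_factorial_le_exp _ hx n
      have hfact : (0 : ℝ) < n.factorial := by exact_mod_cast n.factorial_pos
      have htn : t ^ n ≤ (4 * π ^ 2 * t) ^ n := by
        refine pow_le_pow_left₀ ht.le ?_ n
        nlinarith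
      -- `e^{-4π²t} ≤ n!/tⁿ`
      have h1 : Real.exp (-(4 * π ^ 2 * t)) ≤ (n.factorial : ℝ) * (t ^ n)⁻¹ := by
        have htn0 : 0 < t ^ n := pow_pos ht n
        rw [Real.exp_neg, inv_le_iff_one_le_mul₀ (Real.exp_pos _)]
        have h2 : t ^ n / (n.factorial : ℝ) ≤ Real.exp (4 * π ^ 2 * t) :=
          (div_le_div_of_nonneg_right htn hfact.le).trans hpow
        rw [div_le_iff₀ hfact] at h2
        calc (1 : ℝ) = (n.factorial : ℝ) * (t ^ n)⁻¹ * (t ^ n / (n.factorial : ℝ)) := by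
              field_simp
          _ ≤ (n.factorial : ℝ) * (t ^ n)⁻¹ * Real.exp (4 * π ^ 2 * t) := by
              refine mul_le_mul_of_nonneg_left ?_ (by positivity)
              rw [div_le_iff₀ hfact]
              exact h2
      -- `t^{-n} ≤ t^{-n/2}` for `t ≥ 1`
      have h3 : (t ^ n)⁻¹ ≤ t ^ (-((n : ℝ) / 2)) := by
        rw [← Real.rpow_natCast, ← Real.rpow_neg ht.le]
        refine Real.rpow_le_rpow_of_exponent_le ht1.le ?_
        have : (0 : ℝ) ≤ n := Nat.cast_nonneg n
        linarith
      calc Real.exp (-(4 * π ^ 2 * (t - 1)))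
          = Real.exp (4 * π ^ 2) * Real.exp (-(4 * π ^ 2 * t)) := by
            rw [← Real.exp_add]; congr 1; ring
        _ ≤ Real.exp (4 * π ^ 2) * ((n.factorial : ℝ) * (t ^ n)⁻¹) :=
            mul_le_mul_of_nonneg_left h1 (Real.exp_pos _).le
        _ ≤ Real.exp (4 * π ^ 2) * ((n.factorial : ℝ) * t ^ (-((n : ℝ) / 2))) := by
            gcongr
        _ = Real.exp (4 * π ^ 2) * (n.factorial : ℝ) * t ^ (-((n : ℝ) / 2)) := by ring
    calc (∑' k : d → ℤ, heatCoeff t k) - 1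
        ≤ Real.exp (-(4 * π ^ 2 * (t - 1))) * (Θ₁ - 1) := h
      _ ≤ Real.exp (4 * π ^ 2) * (n.factorial : ℝ) * t ^ (-((n : ℝ) / 2)) * (Θ₁ - 1) :=
          mul_le_mul_of_nonneg_right hexp (by linarith)
      _ = Clarge * t ^ (-((n : ℝ) / 2)) := by rw [hCl]; ring
      _ ≤ (Csmall + Clarge) * t ^ (-((n : ℝ) / 2)) := by
          gcongr
          linarith

end Torus

end Literature.Analysis.FunctionSpaces

end
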